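import Summits.ResolutionOfSingularities.ResolutionOfSingularities.Theorems.WeightedInvariantLocalWeightedDropTupleGameWon
import Summits.ResolutionOfSingularities.ResolutionOfSingularities.Theorems.WeightedInvariantLocalWeightedDropMonomialWon
import Summits.ResolutionOfSingularities.ResolutionOfSingularities.Theorems.WeightedInvariantGlobalizeLocalDropCylinder
import Literature.AlgebraicGeometry.Resolution.CobordantChartPlaneSlice
import Summits.ResolutionOfSingularities.ResolutionOfSingularities.Theorems.WeightedInvariantLocalWeightedDropTrackCMonomialDivisor

/-!
# The tuple game for one marked germ `(a₀, 2)`: the monomial end-game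

[OURS · L1 W4.3 · chain w43, Track T4 (tame double points at N = 4), brick B2; stub worker 4] Engine crux `LocalWeightedDrop`
(stmt-ResolutionOfSingularities-8899).  NOT a statement of any manuscript; the games are the programme's own.

In the coefficient-tuple game `TupleGame.Drop k (n + 1) 0` (ONE entry `a₀ ∈ k⟦x_0,…,x_n⟧` with marking `2`; the tame lift of a
double point `y² + a₀(x)`), a position `v · ∏ x_l^{e_l}` (`v` a unit) is in the inductive winning region `TupleGame.TWon`
(`…TupleGameWon`): `tWon_unit_mul_prod`.  This is the terminal position of every resolution-driven strategy (at the end of an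
embedded resolution the entry is a unit times a monomial in a regular system of parameters).

Strategy (induction on `∑ e_l`): under any `{0,1}`-move the transform of `v · ∏ x_l^{e_l}` at `c` is
`v' · s^D · ∏ (c_l + y_l)^{e_l}`, `D = ∑ w_l e_l` (`subst_chart_unit_mul_prod`), its cofactor prime to `s` (`not_X_dvd_cofactor`), so
the factorisation data are forced; dividing by `s^{2⌊D/2⌋}` and slicing at a live slot leaves a unit-monomial of weight
`D mod 2 + ∑_{c_l = 0} e_l` (`exists_slice_eq`).  Moves: divisorial at a slot with `e_i ≥ 2`, else codimension two at two slots
with `e_i = e_j = 1`; weight `≤ 1` positions have no bad successor (`not_bad_of_sum_le_one`).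
-/

set_option linter.dupNamespace false -- mandated namespace of this single-conjunct summit

namespace Summit.ResolutionOfSingularities.ResolutionOfSingularities.Theorems.TupleMonomial

open MvPowerSeries Literature.AlgebraicGeometry.Resolution Literature.AlgebraicGeometry.Resolution.TupleGame
open Summit.ResolutionOfSingularities.ResolutionOfSingularities.Theorems.TupleGame

variable {k : Type} [Field k] {n : ℕ}

/-! ### Unit-monomial germs -/

/-- The coefficient of `v · ∏ x_l^{e_l}` at the exponent `e` is the constant term of `v`. [OURS · folklore] -/
theorem coeff_unit_mul_prod (v : MvPowerSeries (Fin (n + 1)) k) (e : Fin (n + 1) → ℕ) :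
    coeff (Finsupp.equivFunOnFinite.symm e) (v * ∏ l, X l ^ e l) = constantCoeff v := by
  rw [MonomialWon.prod_X_pow_eq_monomial, coeff_mul_monomial, if_pos le_rfl, tsub_self,
    coeff_zero_eq_constantCoeff_apply, mul_one]

/-- `v · ∏ x_l^{e_l} ≠ 0` for a unit `v`. [OURS · folklore] -/
theorem unit_mul_prod_ne_zero {v : MvPowerSeries (Fin (n + 1)) k} (hv : constantCoeff v ≠ 0) (e : Fin (n + 1) → ℕ) :
    v * ∏ l, X l ^ e l ≠ 0 := by
  intro h
  have h1 := coeff_unit_mul_prod v e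
  rw [h, map_zero] at h1
  exact hv h1.symm

/-- The order of `v · ∏ x_l^{e_l}` is at most `∑ e_l`. [OURS · folklore] -/
theorem order_unit_mul_prod_le {v : MvPowerSeries (Fin (n + 1)) k} (hv : constantCoeff v ≠ 0)
    (e : Fin (n + 1) → ℕ) : (v * ∏ l, X l ^ e l).order ≤ ((∑ l, e l : ℕ) : ℕ∞) := by
  have h := order_le (f := v * ∏ l, X l ^ e l) (d := Finsupp.equivFunOnFinite.symm e)
    (by rw [coeff_unit_mul_prod]; exact hv)
  rw [Finsupp.degree_eq_sum] at h
  simpa using h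

/-- A one-entry tuple `(v · ∏ x_l^{e_l})` with `∑ e_l ≤ 1` is NOT bad (its order is `< 2 =` the marking). [OURS · folklore] -/
theorem not_bad_of_sum_le_one {v : MvPowerSeries (Fin (n + 1)) k} (hv : constantCoeff v ≠ 0)
    {e : Fin (n + 1) → ℕ} (he : ∑ l, e l ≤ 1) : ¬ Bad (fun _ : Fin (0 + 1) => v * ∏ l, X l ^ e l) := by
  intro hbad
  rcases hbad 0 with h | h
  · exact unit_mul_prod_ne_zero hv e h
  · rw [marking_eq] at h
    have h2 := h.trans (order_unit_mul_prod_le hv e)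
    have : (2 : ℕ∞) ≤ ((∑ l, e l : ℕ) : ℕ∞) := by simpa using h2
    have : 2 ≤ ∑ l, e l := by exact_mod_cast this
    omega

/-- The marking of the single slot of a one-entry tuple is `2`. [OURS · folklore] -/
theorem marking_zero_fin_one : marking 0 (0 : Fin (0 + 1)) = 2 := by
  rw [marking_eq]; rfl

/-- The floor weight of a non-zero one-entry tuple with marking `2` is `⌊D₀ / 2⌋`. [OURS · folklore] -/
theorem floorWeight_fin_one {m : ℕ} (a : Fin (0 + 1) → MvPowerSeries (Fin m) k) (ha : a 0 ≠ 0)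
    (D : Fin (0 + 1) → ℕ) : floorWeight a D = D 0 / 2 := by
  unfold floorWeight
  haveI : Nonempty {j : Fin (0 + 1) // a j ≠ 0} := ⟨⟨0, ha⟩⟩
  have hconst : (fun j : {j : Fin (0 + 1) // a j ≠ 0} => D j.1 / marking 0 j.1) = fun _ => D 0 / 2 := by
    funext j
    have hj : j.1 = 0 := Fin.ext (by have := j.1.isLt; omega)
    rw [hj, marking_zero_fin_one]
  rw [hconst, ciInf_const]

/-- The successor of a non-zero one-entry tuple: slice of `s^{D₀ - 2⌊D₀/2⌋} · G₀`. [OURS · folklore] -/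
theorem newTuple_fin_one {m : ℕ} (a : Fin (0 + 1) → MvPowerSeries (Fin m) k) (ha : a 0 ≠ 0)
    (D : Fin (0 + 1) → ℕ) (G : Fin (0 + 1) → MvPowerSeries (Fin (m + 1)) k) (i : Fin m) :
    newTuple a D G i = fun _ => slice i (X 0 ^ (D 0 - 2 * (D 0 / 2)) * G 0) := by
  funext j
  have hj : j = 0 := Fin.ext (by have := j.isLt; omega)
  subst hj
  unfold newTuple
  rw [if_neg ha, floorWeight_fin_one a ha D, marking_zero_fin_one]

/-- `D - 2⌊D/2⌋ = D mod 2`. [OURS · folklore] -/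
theorem sub_two_mul_div_two (D : ℕ) : D - 2 * (D / 2) = D % 2 := by omega

/-- **Transform.** `chart^*(v · ∏ x_l^{e_l}) = chart^*(v) · s^{∑ w_l e_l} · ∏ (c_l + y_l)^{e_l}`. [OURS · folklore] -/
theorem subst_chart_unit_mul_prod (w : Fin (n + 1) → ℕ) (c : Fin (n + 1) → k) (hc : ∀ l, w l = 0 → c l = 0)
    (v : MvPowerSeries (Fin (n + 1)) k) (e : Fin (n + 1) → ℕ) :
    subst (CobordantChart.chart w c) (v * ∏ l, X l ^ e l) =
      subst (CobordantChart.chart w c) v *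
        (X 0 ^ (∑ l, w l * e l) * ∏ l, (C (c l) + X l.succ) ^ e l) := by
  have hch := CobordantChart.hasSubst_chart w c hc
  rw [← coe_substAlgHom hch, map_mul, map_prod]
  congr 1
  simp_rw [map_pow, substAlgHom_apply, subst_X hch, CobordantChart.chart_apply, mul_pow, ← pow_mul]
  rw [Finset.prod_mul_distrib, Finset.prod_pow_eq_pow_sum]

/-- The substitution killing `s = X 0`. [OURS · folklore] -/
theorem hasSubst_killX0 {m : ℕ} :
    HasSubst (fun j : Fin (m + 1) => if j = 0 then (0 : MvPowerSeries (Fin (m + 1)) k) else X j) :=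
  hasSubst_of_constantCoeff_zero fun j => by split_ifs <;> simp [constantCoeff_X]

/-- **The cofactor is prime to `s`:** `s ∤ v' · ∏ (c_l + y_l)^{e_l}` for a unit `v'` (kill `s`: the image is a unit times a
product of non-zero series in a domain). [OURS · folklore] -/
theorem not_X_dvd_cofactor {v' : MvPowerSeries (Fin (n + 1 + 1)) k} (hv' : constantCoeff v' ≠ 0)
    (c : Fin (n + 1) → k) (e : Fin (n + 1) → ℕ) :
    ¬ X 0 ∣ v' * ∏ l, (C (c l) + X l.succ) ^ e l := by
  rintro ⟨Q, hQ⟩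
  let κ : Fin (n + 1 + 1) → MvPowerSeries (Fin (n + 1 + 1)) k := fun j => if j = 0 then 0 else X j
  have hκ : HasSubst κ := hasSubst_killX0
  have hκ0 : ∀ j, constantCoeff (κ j) = 0 := fun j => by
    by_cases hj : j = 0 <;> simp [κ, hj, constantCoeff_X]
  have h := congrArg (subst κ) hQ
  rw [← coe_substAlgHom hκ, map_mul, map_mul, map_prod, substAlgHom_apply, substAlgHom_apply,
    substAlgHom_apply, subst_X hκ] at h
  simp only [κ, if_true] at h
  rw [zero_mul] at h
  have hfac : ∀ l : Fin (n + 1), substAlgHom hκ ((C (c l) + X l.succ) ^ e l) = (C (c l) + X l.succ) ^ e l := by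
    intro l
    rw [map_pow, map_add, substAlgHom_apply, substAlgHom_apply, subst_C, subst_X hκ]
    simp [κ, Fin.succ_ne_zero]
  simp_rw [hfac] at h
  haveI : IsDomain (MvPowerSeries (Fin (n + 1 + 1)) k) := NoZeroDivisors.to_isDomain _
  rcases mul_eq_zero.mp h with h1 | h1
  · have : constantCoeff (subst κ v') = constantCoeff v' := constantCoeff_subst_of_constantCoeff_zero κ hκ0 v'
    rw [h1, map_zero] at this
    exact hv' this.symm
  · obtain ⟨l, -, hl⟩ := Finset.prod_eq_zero_iff.mp h1
    have hne : (C (c l) + X l.succ : MvPowerSeries (Fin (n + 1 + 1)) k) ≠ 0 := by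
      intro h0
      have := congrArg (coeff (Finsupp.single l.succ 1)) h0
      rw [map_add, coeff_C, if_neg (Finsupp.single_ne_zero.mpr one_ne_zero), coeff_X, if_pos rfl, map_zero,
        zero_add] at this
      exact one_ne_zero this
    exact hne (pow_eq_zero_iff'.mp hl).1


/-- **Slice.** At a live slot `i` (`c_i ≠ 0`), the slice `y_i ↦ 0` of `s^r · v' · ∏ (c_l + y_l)^{e_l}` is a unit times a
monomial of weight `r + ∑_{c_l = 0} e_l` (the factors with `c_l ≠ 0` are units; those with `c_l = 0` are variables).
[OURS · folklore] -/
theorem exists_slice_eq [DecidableEq k] (i : Fin (n + 1)) (c : Fin (n + 1) → k) (hci : c i ≠ 0)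
    {v' : MvPowerSeries (Fin (n + 1 + 1)) k} (hv' : constantCoeff v' ≠ 0) (r : ℕ) (e : Fin (n + 1) → ℕ) :
    ∃ (v'' : MvPowerSeries (Fin (n + 1)) k) (e' : Fin (n + 1) → ℕ), constantCoeff v'' ≠ 0 ∧
      slice i (X 0 ^ r * (v' * ∏ l, (C (c l) + X l.succ) ^ e l)) = v'' * ∏ m, X m ^ e' m ∧
      ∑ m, e' m = r + ∑ l ∈ Finset.univ.filter (fun l => c l = 0), e l := by
  set σ : Fin (n + 1 + 1) → MvPowerSeries (Fin (n + 1)) k :=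
    fun j => if j = i.succ then (0 : MvPowerSeries (Fin (n + 1)) k) else X (Fin.predAbove i j) with hσdef
  have hσ : HasSubst σ := CobordantChartPlaneSlice.hasSubst_slice (R := k) i
  have hσ0 : ∀ j, constantCoeff (σ j) = 0 := fun j => by
    by_cases hj : j = i.succ <;> simp [σ, hj, constantCoeff_X]
  have hslice : ∀ P : MvPowerSeries (Fin (n + 1 + 1)) k, slice i P = subst σ P := fun P => rfl
  -- images of the generators
  have hX0 : subst σ (X 0 : MvPowerSeries (Fin (n + 1 + 1)) k) = (X 0 : MvPowerSeries (Fin (n + 1)) k) := by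
    rw [subst_X hσ]
    simp [σ, (Fin.succ_ne_zero i).symm, Fin.predAbove_right_zero]
  let π : Fin (n + 1) → Fin (n + 1) := fun l => Fin.predAbove i l.succ
  have hfac : ∀ l, subst σ (C (c l) + X l.succ) =
      C (c l) + (if l = i then (0 : MvPowerSeries (Fin (n + 1)) k) else X (π l)) := by
    intro l
    rw [← coe_substAlgHom hσ, map_add, substAlgHom_apply, substAlgHom_apply, subst_C, subst_X hσ]
    simp [σ, π, Fin.succ_inj]
  -- the two kinds of factors
  set S0 := Finset.univ.filter (fun l : Fin (n + 1) => c l = 0) with hS0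
  set S1 := Finset.univ.filter (fun l : Fin (n + 1) => ¬ c l = 0) with hS1
  have hunitfac : ∀ l ∈ S1, constantCoeff ((C (c l) + (if l = i then (0 : MvPowerSeries (Fin (n + 1)) k)
      else X (π l))) ^ e l) = c l ^ e l := by
    intro l _
    rw [map_pow, map_add, constantCoeff_C]
    split_ifs <;> simp [constantCoeff_X]
  have hvarfac : ∀ l ∈ S0, (C (c l) + (if l = i then (0 : MvPowerSeries (Fin (n + 1)) k) else X (π l))) ^ e l =
      X (π l) ^ e l := by
    intro l hl
    have hl0 : c l = 0 := (Finset.mem_filter.mp hl).2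
    have hli : l ≠ i := fun h => hci (h ▸ hl0)
    rw [hl0, map_zero, zero_add, if_neg hli]
  -- the unit and the exponent of the slice
  refine ⟨subst σ v' * ∏ l ∈ S1, (C (c l) + (if l = i then (0 : MvPowerSeries (Fin (n + 1)) k) else X (π l))) ^ e l,
    fun m => (if m = 0 then r else 0) + ∑ l ∈ S0, (if π l = m then e l else 0), ?_, ?_, ?_⟩
  · rw [map_mul, map_prod, constantCoeff_subst_of_constantCoeff_zero σ hσ0 v']
    refine mul_ne_zero hv' (Finset.prod_ne_zero_iff.mpr fun l hl => ?_)
    rw [hunitfac l hl]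
    exact pow_ne_zero _ (Finset.mem_filter.mp hl).2
  · rw [hslice, ← coe_substAlgHom hσ, map_mul, map_mul, map_pow, map_prod]
    simp_rw [map_pow]
    simp only [substAlgHom_apply]
    rw [hX0]
    simp_rw [hfac]
    rw [← Finset.prod_filter_mul_prod_filter_not Finset.univ (fun l : Fin (n + 1) => c l = 0), ← hS0, ← hS1,
      Finset.prod_congr rfl hvarfac]
    -- ∏_m X_m^{e'_m} = X_0^r · ∏_{l ∈ S0} X_{π l}^{e_l}
    have hexp : (∏ m : Fin (n + 1), (X m : MvPowerSeries (Fin (n + 1)) k) ^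
        ((if m = 0 then r else 0) + ∑ l ∈ S0, (if π l = m then e l else 0))) =
        X 0 ^ r * ∏ l ∈ S0, X (π l) ^ e l := by
      simp_rw [pow_add, Finset.prod_mul_distrib]
      congr 1
      · rw [Finset.prod_eq_single (0 : Fin (n + 1))]
        · simp
        · intro m _ hm; simp [hm]
        · intro h; exact absurd (Finset.mem_univ _) h
      · simp_rw [← Finset.prod_pow_eq_pow_sum]
        rw [Finset.prod_comm]
        refine Finset.prod_congr rfl fun l _ => ?_
        rw [Finset.prod_eq_single (π l)]
        · simp
        · intro m _ hm; rw [if_neg (Ne.symm hm), pow_zero]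
        · intro h; exact absurd (Finset.mem_univ _) h
    rw [hexp]
    ring
  · rw [Finset.sum_add_distrib, Finset.sum_ite_eq' Finset.univ (0 : Fin (n + 1)), if_pos (Finset.mem_univ _),
      Finset.sum_comm]
    congr 1
    refine Finset.sum_congr rfl fun l _ => ?_
    rw [Finset.sum_ite_eq Finset.univ (π l), if_pos (Finset.mem_univ _)]

/-- **Generic move.** Play `(X, w, sel)` with `w ∈ {0,1}^{n+1}` and a live slot selector from the unit-monomial position
`v · ∏ x_l^{e_l}`: every bad successor is a unit-monomial position of weight `(∑ w_l e_l) mod 2 + ∑_{c_l = 0} e_l`, so it suffices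
to win those. [OURS · folklore] -/
theorem tWon_of_move [DecidableEq k] (w : Fin (n + 1) → ℕ) (hw1 : ∀ l, w l ≤ 1) (hw : ∃ l, 0 < w l)
    (sel : (Fin (n + 1) → k) → Fin (n + 1))
    (hsel : ∀ c : Fin (n + 1) → k, (∀ l, w l = 0 → c l = 0) → c ≠ 0 → c (sel c) ≠ 0)
    (e : Fin (n + 1) → ℕ) (v : MvPowerSeries (Fin (n + 1)) k) (hv : constantCoeff v ≠ 0)
    (hsucc : ∀ c : Fin (n + 1) → k, (∀ l, w l = 0 → c l = 0) → c ≠ 0 →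
      ∀ (e' : Fin (n + 1) → ℕ) (v'' : MvPowerSeries (Fin (n + 1)) k), constantCoeff v'' ≠ 0 →
        ∑ m, e' m = (∑ l, w l * e l) % 2 + ∑ l ∈ Finset.univ.filter (fun l => c l = 0), e l →
        Bad (fun _ : Fin (0 + 1) => v'' * ∏ m, X m ^ e' m) →
        TWon k (n + 1) 0 (fun _ : Fin (0 + 1) => v'' * ∏ m, X m ^ e' m)) :
    TWon k (n + 1) 0 (fun _ : Fin (0 + 1) => v * ∏ l, X l ^ e l) := by
  refine TWon.move MvPowerSeries.X w (fun c _ _ => sel c) (fun i => constantCoeff_X i) ?_ hw1 hw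
    (fun c hc0 hc D G _ => hsel c hc0 hc) (fun c hc0 hc D G hDG hne hbad => ?_)
  · rw [linMat_X_eq_one, Matrix.det_one]; exact isUnit_one
  have hb : (fun _ : Fin (0 + 1) => v * ∏ l, X l ^ e l) 0 ≠ 0 := unit_mul_prod_ne_zero hv e
  obtain ⟨hfac, hndvd⟩ := hDG 0 hb
  have hch0 : ∀ l, constantCoeff (CobordantChart.chart w c l) = 0 := CobordantArc.constantCoeff_chart w c hc0
  have hv' : constantCoeff (subst (CobordantChart.chart w c) v) ≠ 0 := by
    rw [constantCoeff_subst_of_constantCoeff_zero _ hch0 v]; exact hv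
  rw [subst_self, id, subst_chart_unit_mul_prod w c hc0 v e, mul_left_comm] at hfac
  obtain ⟨hD, hG⟩ := X_pow_mul_eq_X_pow_mul 0 hfac (not_X_dvd_cofactor hv' c e) hndvd
  obtain ⟨v'', e', hv'', hEq, hsum⟩ := exists_slice_eq (sel c) c (hsel c hc0 hc) hv' ((∑ l, w l * e l) % 2) e
  rw [newTuple_fin_one _ hb D G (sel c), sub_two_mul_div_two, ← hD, ← hG, hEq] at hbad ⊢
  exact hsucc c hc0 hc e' v'' hv'' hsum hbad

/-- The weights of the divisorial move at `i`. [OURS · folklore] -/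
theorem sum_single_mul (i : Fin (n + 1)) (e : Fin (n + 1) → ℕ) : ∑ l, (Pi.single i 1 : Fin (n + 1) → ℕ) l * e l = e i := by
  rw [Finset.sum_eq_single i]
  · simp
  · intro l _ hl; rw [Pi.single_eq_of_ne hl, zero_mul]
  · intro h; exact absurd (Finset.mem_univ _) h

/-- At an exceptional point of the divisorial move at `i`, the only live slot is `i`. [OURS · folklore] -/
theorem eq_zero_of_single {i : Fin (n + 1)} {c : Fin (n + 1) → k}
    (hc0 : ∀ l, (Pi.single i 1 : Fin (n + 1) → ℕ) l = 0 → c l = 0) {l : Fin (n + 1)} (hl : l ≠ i) : c l = 0 :=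
  hc0 l (by rw [Pi.single_eq_of_ne hl])

/-- … hence `c_i ≠ 0`. [OURS · folklore] -/
theorem ne_zero_of_single {i : Fin (n + 1)} {c : Fin (n + 1) → k}
    (hc0 : ∀ l, (Pi.single i 1 : Fin (n + 1) → ℕ) l = 0 → c l = 0) (hc : c ≠ 0) : c i ≠ 0 := by
  intro hci
  apply hc
  funext l
  by_cases hl : l = i
  · rw [hl, hci]; rfl
  · exact eq_zero_of_single hc0 hl

/-- The exponent sum splits over `{c_l = 0}` and `{c_l ≠ 0}`. [OURS · folklore] -/
theorem sum_eq_filter_add [DecidableEq k] (c : Fin (n + 1) → k) (e : Fin (n + 1) → ℕ) :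
    ∑ l, e l = ∑ l ∈ Finset.univ.filter (fun l => c l = 0), e l + ∑ l ∈ Finset.univ.filter (fun l => ¬ c l = 0), e l :=
  (Finset.sum_filter_add_sum_filter_not _ _ _).symm

/-- **THE MONOMIAL END-GAME of the one-entry tuple game.** In every dimension `n + 1 ≥ 1` and over every field, a unit times a
monomial is in the inductive winning region `TWon k (n + 1) 0` of the coefficient-tuple game with one entry of marking `2`.
[OURS · L1 W4.3 · Track T4 brick B2] -/
theorem tWon_unit_mul_prod (S : ℕ) : ∀ (e : Fin (n + 1) → ℕ), ∑ l, e l ≤ S →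
    ∀ (v : MvPowerSeries (Fin (n + 1)) k), constantCoeff v ≠ 0 →
      TWon k (n + 1) 0 (fun _ : Fin (0 + 1) => v * ∏ l, X l ^ e l) := by
  classical
  induction S using Nat.strong_induction_on with
  | _ S IH =>
  intro e heS v hv
  by_cases hA : ∃ i, 2 ≤ e i
  · -- divisorial move at a slot with `e_i ≥ 2`: the weight drops by `e_i - e_i mod 2 ≥ 2`
    obtain ⟨i, hi⟩ := hA
    refine tWon_of_move (Pi.single i 1) (fun l => by by_cases h : l = i <;> simp [h]) ⟨i, by simp⟩ (fun _ => i)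
      (fun c hc0 hc => ne_zero_of_single hc0 hc) e v hv fun c hc0 hc e' v'' hv'' hsum _ => ?_
    have hS1 : ∑ l ∈ Finset.univ.filter (fun l => ¬ c l = 0), e l = e i := by
      have hfilter : Finset.univ.filter (fun l => ¬ c l = 0) = {i} := by
        ext l
        simp only [Finset.mem_filter, Finset.mem_univ, true_and, Finset.mem_singleton]
        exact ⟨fun h => by_contra fun hl => h (eq_zero_of_single hc0 hl), fun h => h ▸ ne_zero_of_single hc0 hc⟩
      rw [hfilter, Finset.sum_singleton]
    have hsplit := sum_eq_filter_add c e
    rw [sum_single_mul] at hsum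
    have hlt : ∑ m, e' m < S := by have := Nat.mod_lt (e i) two_pos; omega
    exact IH _ hlt e' le_rfl v'' hv''
  push Not at hA
  by_cases hB : ∃ i j, i ≠ j ∧ e i = 1 ∧ e j = 1
  · -- codimension-two move at two slots with `e_i = e_j = 1`: the weight drops by at least one
    obtain ⟨i, j, hij, hei, hej⟩ := hB
    refine tWon_of_move (fun l => if l = i ∨ l = j then 1 else 0) (fun l => by by_cases h : l = i ∨ l = j <;> simp [h])
      ⟨i, by simp⟩ (fun c => if c i ≠ 0 then i else j) (fun c hc0 hc => ?_) e v hv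
      fun c hc0 hc e' v'' hv'' hsum _ => ?_
    · by_cases hci : c i ≠ 0
      · simp only [hci, ne_eq, not_false_eq_true, if_true]
      · simp only [hci, if_false]
        intro hcj
        push Not at hci
        apply hc
        funext l
        by_cases hl : l = i ∨ l = j
        · rcases hl with rfl | rfl
          · exact hci
          · exact hcj
        · exact hc0 l (by simp [hl])
    · have hw2 : ∑ l, (if l = i ∨ l = j then 1 else 0) * e l = 2 := by
        rw [← Finset.sum_filter_add_sum_filter_not Finset.univ (fun l => l = i ∨ l = j)]
        have hf : Finset.univ.filter (fun l : Fin (n + 1) => l = i ∨ l = j) = {i, j} := by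
          ext l; simp [Finset.mem_insert, Finset.mem_singleton]
        rw [hf, Finset.sum_pair hij]
        have hrest : ∑ l ∈ Finset.univ.filter (fun l : Fin (n + 1) => ¬ (l = i ∨ l = j)),
            (if l = i ∨ l = j then 1 else 0) * e l = 0 :=
          Finset.sum_eq_zero fun l hl => by rw [if_neg (Finset.mem_filter.mp hl).2, zero_mul]
        rw [hrest, if_pos (Or.inl rfl), if_pos (Or.inr rfl), hei, hej]
      rw [hw2] at hsum
      -- a live slot carries exponent `1`
      have hlive : ∃ l, c l ≠ 0 ∧ e l = 1 := by
        by_cases hci : c i ≠ 0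
        · exact ⟨i, hci, hei⟩
        · push Not at hci
          refine ⟨j, fun hcj => hc ?_, hej⟩
          funext l
          by_cases hl : l = i ∨ l = j
          · rcases hl with rfl | rfl
            · exact hci
            · exact hcj
          · exact hc0 l (by simp [hl])
      obtain ⟨l₀, hl₀, hel₀⟩ := hlive
      have hS1 : 1 ≤ ∑ l ∈ Finset.univ.filter (fun l => ¬ c l = 0), e l := by
        have hmem : l₀ ∈ Finset.univ.filter (fun l => ¬ c l = 0) := Finset.mem_filter.mpr ⟨Finset.mem_univ _, hl₀⟩
        have := Finset.single_le_sum (fun l _ => Nat.zero_le (e l)) hmem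
        omega
      have hsplit := sum_eq_filter_add c e
      have hlt : ∑ m, e' m < S := by omega
      exact IH _ hlt e' le_rfl v'' hv''
  push Not at hB
  -- at most one slot carries `1`, all others `0`: weight `≤ 1`
  by_cases hC : ∃ i, e i = 1
  · obtain ⟨i, hei⟩ := hC
    have hothers : ∀ l, l ≠ i → e l = 0 := by
      intro l hl
      have h1 := hA l
      by_contra h0
      have : e l = 1 := by omega
      exact absurd hei (hB l i hl this)
    refine tWon_of_move (Pi.single i 1) (fun l => by by_cases h : l = i <;> simp [h]) ⟨i, by simp⟩ (fun _ => i)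
      (fun c hc0 hc => ne_zero_of_single hc0 hc) e v hv fun c hc0 hc e' v'' hv'' hsum hbad => ?_
    exfalso
    refine not_bad_of_sum_le_one hv'' ?_ hbad
    rw [sum_single_mul, hei] at hsum
    have h0 : ∑ l ∈ Finset.univ.filter (fun l => c l = 0), e l = 0 :=
      Finset.sum_eq_zero fun l hl => hothers l fun hli => ne_zero_of_single hc0 hc (hli ▸ (Finset.mem_filter.mp hl).2)
    omega
  · push Not at hC
    have h0 : ∀ l, e l = 0 := fun l => by have := hA l; have := hC l; omega
    refine tWon_of_move (Pi.single 0 1) (fun l => by by_cases h : l = 0 <;> simp [h]) ⟨0, by simp⟩ (fun _ => 0)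
      (fun c hc0 hc => ne_zero_of_single hc0 hc) e v hv fun c hc0 hc e' v'' hv'' hsum hbad => ?_
    exfalso
    refine not_bad_of_sum_le_one hv'' ?_ hbad
    rw [sum_single_mul, h0] at hsum
    have hz : ∑ l ∈ Finset.univ.filter (fun l => c l = 0), e l = 0 := Finset.sum_eq_zero fun l _ => h0 l
    omega

/-- **The monomial end-game, product form.** [OURS · L1 W4.3 · Track T4 brick B2] -/
theorem tWon_unit_mul_prod' {v : MvPowerSeries (Fin (n + 1)) k} (hv : constantCoeff v ≠ 0) (e : Fin (n + 1) → ℕ) :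
    TWon k (n + 1) 0 (fun _ : Fin (0 + 1) => v * ∏ l, X l ^ e l) :=
  tWon_unit_mul_prod _ e le_rfl v hv

/-- **The monomial end-game, divisor form:** every divisor of a unit times a monomial is won. [OURS · L1 W4.3 · Track T4 brick B2] -/
theorem tWon_of_dvd_unit_mul_prod {u : MvPowerSeries (Fin (n + 1)) k} (hu : constantCoeff u ≠ 0) (e : Fin (n + 1) → ℕ)
    (b : MvPowerSeries (Fin (n + 1)) k) (hb : b ∣ u * ∏ l, X l ^ e l) :
    TWon k (n + 1) 0 (fun _ : Fin (0 + 1) => b) := by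
  obtain ⟨v, e', hv, rfl⟩ := TrackC.exists_eq_unit_mul_monomial_of_dvd u hu e b hb
  exact tWon_unit_mul_prod' hv e'

end Summit.ResolutionOfSingularities.ResolutionOfSingularities.Theorems.TupleMonomial
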